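import Literature.NumberTheory.EllipticCurves.TianYuanZhang2017.CMPointClassFieldReduced
import Literature.NumberTheory.EllipticCurves.TianYuanZhang2017.CurveAFourTorsion
import HarnessLib

/-!
# Route B's displayed hypothesis REDUCED AGAIN: the «`#A(ℍ′_n)[4] = 16`» half of Lemma 3.18 (`n` even) is a kernel
# theorem of the data (`i, √−2 ∈ ℍ′_n`), and two rendering redundancies — the named fact
# `tyz_cmPointClassFieldDataTorsion` ⟺ `tyz_cmPointClassFieldDataReduced` ⟺ `tyz_cmPointClassFieldData`

A SECOND derivability pass over route B's displayed hypothesis (cell `bsd-monsky`, typer seat g17; the first pass is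
`CMPointClassFieldReduced.lean`, hCF′ = `tyz_cmPointClassFieldDataReduced`).  Three more displayed conjuncts are kernel
consequences of the others; this file proves them, displays the hypothesis with them struck, and proves the named facts
EQUIVALENT.  Nothing is asserted (no `_holds`); no count moves.

## The struck conjuncts and their derivations

1. **«`A(ℍ′_n)` has `16` points killed by `4`»** — the half «`A[4] ⊆ A(ℍ′_n)`» of Lemma 3.18's «`A(ℍ′_n)_tor = A[4]` if `n`
   is even» ([TianYuanZhang2017] p0017 L152–L153), displayed in `GenusPointData.lemma318` as
   `Nat.card {Q : APoint D.H // 4 • Q = 0} = 16` — is a kernel theorem of the DATA alone: `i ∈ ℍ′_n` (`D.im`) and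
   `√−2 ∈ ℍ′_n` (`D.sqrtNeg 2`, `2 ∣ n`), hence `√2 = i·√−2 ∈ ℍ′_n`, and the curve `A : Y² = X³ + 4X` has exactly sixteen
   `4`-torsion points over any field of characteristic `0` containing `i` and `√2` (`CurveAFourTorsion.lean`:
   `A(H)[2] = {O, (0,0), (±2i, 0)}`, the halves `τ(1/2) = (2, 4)`, `(2i(1 + √2), (2√2 + 4)(1 − i))` and its `[i]`-image,
   `A(H)[4] ↪ A(H)[2]²` and `Fin 4 × Fin 4 ↪ A(H)[4]`).  This is a CONTENT removal: the sentence is half of a printed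
   lemma, and what remains — the other half «every torsion point is killed by `4`» — does not state it.
2. **«`2·(2Q) = 0`» for torsion `Q`, `n` odd** — the first half of `lemma318`'s odd clause «`A(ℍ′_n)_tor ⊆ A[(1+i)³]`»,
   rendered as `2(2Q) = 0 ∧ 2Q ∈ {0, τ(1)}` — follows from its second half (`2τ(1) = 0`): a rendering redundancy of the
   display, not a printed sentence; no content is claimed for its removal.
3. **«`c(i) = −i`»** — the first conjunct of `ConjSpec` («complex conjugation restricted to `ℍ′_n`»: `c(i) = −i`,
   `c(√−d′) = −√−d′` for `d′ ∣ n`, `c² = 1`) — is the instance `d′ = 1` of the second (`√−1 = ±i`): again a rendering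
   redundancy; no content is claimed.

`lemma318Core` (= `lemma318` with the two halves struck), `ConjSpecCore` (= `ConjSpec` minus its first conjunct),
`PrintedTorsion` (= `PrintedCore` with `lemma318 ↦ lemma318Core`), `CMPointClassFieldPrintedTorsion` (=
`CMPointClassFieldPrintedReduced` with `ConjSpec ↦ ConjSpecCore`), and the named fact **hCF″ =
`tyz_cmPointClassFieldDataTorsion`** with `tyz_cmPointClassFieldDataReduced_iff_torsion` and
`tyz_cmPointClassFieldData_iff_torsion` (hCF ⟺ hCF′ ⟺ hCF″ in the kernel).  What remains of `lemma318` — «every torsion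
point of `A(ℍ′_n)` is killed by `4`» (`n` even) and «`2Q ∈ {0, τ(1)}` for every torsion `Q`» (`n` odd) — is the only
displayed sentence on the torsion of `A(ℍ′_n)` and is not derivable from the rest (the display does not bound the
torsion of an abstract number field's points); no minimality is claimed.  HONEST FRAMING: hCF″ is a named fact with NO
`_holds`; consumers take it as a hypothesis; every consumer of `tyz_cmPointClassFieldData` runs unchanged through
`tyz_cmPointClassFieldData_of_torsion`.  Origin: cell `bsd-monsky` (run/shared/lean/pub/bsd-monsky/), typer seat g17.

References: [TianYuanZhang2017] Lemma 3.16 (p0017 L98–L113), Lemma 3.18 (p0017 L152–L153), Thm. 3.6 (J741 = p0012 L22–L36),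
§3.1 (p0011 L60–L64); [SilvermanAEC2009] III.2.3, III.6.4.
-/

noncomputable section

open scoped Classical

open WeierstrassCurve WeierstrassCurve.Affine Finset

namespace Literature.NumberTheory.EllipticCurves.TianYuanZhang2017

namespace GenusPointData

variable {n : ℕ}

/-! ## §1 Lemma 3.18 with the two derivable halves struck -/

/-- **Lemma 3.18 with the halves «`2(2Q) = 0`» (`n` odd) and «`#A(ℍ′_n)[4] = 16`» (`n` even) struck**: for `n` odd every
torsion point has `2Q ∈ {0, τ(1)}`; for `n` even every torsion point is killed by `4`. A predicate; nothing asserted.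
[cite: TianYuanZhang2017, Lemma 3.18 (chunk p0017 L152–L153); Lemma 3.16 (p0017 L98–L101)] -/
def lemma318Core (D : GenusPointData n) : Prop :=
  (Odd n → ∀ Q : APoint D.H, IsOfFinAddOrder Q → ((2 : ℕ) • Q = 0 ∨ (2 : ℕ) • Q = tauOne)) ∧
  (Even n → ∀ Q : APoint D.H, IsOfFinAddOrder Q → (4 : ℕ) • Q = 0)

/-- `lemma318 ⟹ lemma318Core` (drop the two halves). [cite: TianYuanZhang2017, Lemma 3.18 (p0017 L152–L153)] -/
theorem lemma318Core_of_lemma318 (D : GenusPointData n) (h : D.lemma318) : D.lemma318Core :=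
  ⟨fun hodd Q hQ => (h.1 hodd Q hQ).2, fun heven => (h.2 heven).1⟩

/-- **`lemma318Core ⟹ lemma318`** for `n ≠ 0`: `2(2Q) = 0` from `2Q ∈ {0, τ(1)}` and `2τ(1) = 0`; `#A(ℍ′_n)[4] = 16` from
`i, √−2 ∈ ℍ′_n` (`card_four_torsion_of_data`). [cite: TianYuanZhang2017, Lemma 3.18 (p0017 L152–L153), Lemma 3.16 (p0017 L98–L113)]
[cite: SilvermanAEC2009, III.2.3, III.6.4] -/
theorem lemma318_of_core (D : GenusPointData n) (hn : n ≠ 0) (h : D.lemma318Core) : D.lemma318 := by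
  refine ⟨fun hodd Q hQ => ⟨?_, h.1 hodd Q hQ⟩, fun heven => ⟨h.2 heven, D.card_four_torsion_of_data hn heven⟩⟩
  rcases h.1 hodd Q hQ with h0 | h0
  · rw [h0, smul_zero]
  · rw [h0, two_nsmul_tauOne]

/-- **`lemma318 ⟺ lemma318Core`** for `n ≠ 0`. [cite: TianYuanZhang2017, Lemma 3.18 (p0017 L152–L153)] -/
theorem lemma318_iff_core (D : GenusPointData n) (hn : n ≠ 0) : D.lemma318 ↔ D.lemma318Core :=
  ⟨D.lemma318Core_of_lemma318, D.lemma318_of_core hn⟩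

/-- **`PrintedCore` with `lemma318 ↦ lemma318Core`** (the nine other conjuncts VERBATIM, in the same order).
A predicate; nothing asserted. [cite: TianYuanZhang2017, §3 (Prop. 3.4, Thm. 3.5, Lemma 3.18, Lemma 3.21, proof of Thm. 3.5 (2))] -/
def PrintedTorsion (D : GenusPointData n) : Prop :=
  D.scriptLSpec ∧ D.epsSpec ∧ D.recursion ∧ D.prop34 ∧ D.thm35Main ∧ D.thm35Bullet1 ∧
    D.thm35Bullet2Ie ∧ D.lemma318Core ∧ D.betaSpec ∧ D.lemma321

/-- `PrintedCore ⟹ PrintedTorsion`. [cite: TianYuanZhang2017, §3] -/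
theorem printedTorsion_of_printedCore (D : GenusPointData n) (h : D.PrintedCore) : D.PrintedTorsion := by
  obtain ⟨h1, h2, h3, h4, h5, h6, h7, h8, h9, h10⟩ := h
  exact ⟨h1, h2, h3, h4, h5, h6, h7, D.lemma318Core_of_lemma318 h8, h9, h10⟩

/-- `PrintedTorsion ⟹ PrintedCore` for `n ≠ 0`. [cite: TianYuanZhang2017, Lemma 3.18 (p0017 L152–L153)] -/
theorem printedCore_of_printedTorsion (D : GenusPointData n) (hn : n ≠ 0) (h : D.PrintedTorsion) : D.PrintedCore := by
  obtain ⟨h1, h2, h3, h4, h5, h6, h7, h8, h9, h10⟩ := h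
  exact ⟨h1, h2, h3, h4, h5, h6, h7, D.lemma318_of_core hn h8, h9, h10⟩

/-- **`PrintedCore ⟺ PrintedTorsion`** for `n ≠ 0`. [cite: TianYuanZhang2017, Lemma 3.18 (p0017 L152–L153)] -/
theorem printedCore_iff_printedTorsion (D : GenusPointData n) (hn : n ≠ 0) : D.PrintedCore ↔ D.PrintedTorsion :=
  ⟨D.printedTorsion_of_printedCore, D.printedCore_of_printedTorsion hn⟩

/-! ## §2 Complex conjugation with «`c(i) = −i`» struck -/

/-- **`ConjSpec` minus its first conjunct**: `c(√−d′) = −√−d′` for `d′ ∣ n`, `c² = 1`. A predicate; nothing asserted.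
[cite: TianYuanZhang2017, Thm. 3.6 (J741 = p0012 L22–L36)] -/
def ConjSpecCore (D : GenusPointData n) (c : D.H ≃ₐ[ℚ] D.H) : Prop :=
  (∀ d' ∈ n.divisors, c (D.sqrtNeg d') = -D.sqrtNeg d') ∧ c * c = 1

/-- `ConjSpec ⟹ ConjSpecCore`. [cite: TianYuanZhang2017, Thm. 3.6 (J741)] -/
theorem conjSpecCore_of_conjSpec (D : GenusPointData n) {c : D.H ≃ₐ[ℚ] D.H} (h : D.ConjSpec c) : D.ConjSpecCore c :=
  ⟨h.2.1, h.2.2⟩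

/-- **`ConjSpecCore ⟹ ConjSpec`** for `n ≠ 0`: `√−1 = ±i` (the data's `sqrtNeg 1` squares to `−1 = i²`), so `c(i) = −i`
is the instance `d′ = 1` of `c(√−d′) = −√−d′`. [cite: TianYuanZhang2017, Thm. 3.6 (J741 = p0012 L22–L36), §3.1 (p0011 L60–L64)] -/
theorem conjSpec_of_core (D : GenusPointData n) (hn : n ≠ 0) {c : D.H ≃ₐ[ℚ] D.H} (h : D.ConjSpecCore c) :
    D.ConjSpec c := by
  refine ⟨?_, h.1, h.2⟩
  have h1 : 1 ∈ n.divisors := Nat.mem_divisors.mpr ⟨one_dvd n, hn⟩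
  have hsq : D.sqrtNeg 1 ^ 2 = D.im ^ 2 := by rw [D.sqrtNeg_sq 1 h1, D.im_sq]; push_cast; ring
  have hc := h.1 1 h1
  rcases sq_eq_sq_iff_eq_or_eq_neg.mp hsq with e | e
  · rw [e] at hc; exact hc
  · rw [e, map_neg, neg_inj] at hc
    exact hc

/-- **`ConjSpec ⟺ ConjSpecCore`** for `n ≠ 0`. [cite: TianYuanZhang2017, Thm. 3.6 (J741)] -/
theorem conjSpec_iff_core (D : GenusPointData n) (hn : n ≠ 0) (c : D.H ≃ₐ[ℚ] D.H) :
    D.ConjSpec c ↔ D.ConjSpecCore c :=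
  ⟨D.conjSpecCore_of_conjSpec, D.conjSpec_of_core hn⟩

/-! ## §3 The block layer with `ConjSpec ↦ ConjSpecCore` -/

/-- **`CMPointClassFieldPrintedReduced` with `ConjSpec ↦ ConjSpecCore`** (everything else VERBATIM). A predicate; nothing
asserted. [cite: TianYuanZhang2017, §3.1 (J738–J739), Prop. 3.2 (1)(2)(3), Thm. 3.6 (1)(2) (J741), proof of Lemma 3.21 (J759)]
[cite: Cox2013, Theorem 6.1 (ii) and Theorem 9.18] -/
def CMPointClassFieldPrintedTorsion (D : GenusPointData n) : Prop :=
  ∃ (C : D.ClassFieldData) (z : ℕ → APoint D.H) (Φ : ℕ → Finset (D.H ≃ₐ[ℚ] D.H))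
    (ΓH ΓH' : ℕ → Subgroup (D.H ≃ₐ[ℚ] D.H)) (σ θ : ℕ → (D.H ≃ₐ[ℚ] D.H)) (c : D.H ≃ₐ[ℚ] D.H),
    D.ConjSpecCore c ∧ C.CoxDisplays c ∧
    ∀ d ∈ n.divisors,
      ((d % 8 = 5 ∨ d % 8 = 6) → C.CMBlockClassFieldSpecReduced d (z d) (Φ d) (ΓH d) (ΓH' d) (σ d) c) ∧
      (d % 8 = 6 → D.ThetaBlockSpecReduced (z d) (ΓH d) (ΓH' d) (σ d) (θ d)) ∧
      (d % 8 = 7 → C.SevenBlockClassFieldSpec d)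

/-- `CMPointClassFieldPrintedReduced ⟹ CMPointClassFieldPrintedTorsion`. [cite: TianYuanZhang2017, §3.1, Thm. 3.6] -/
theorem cmPointClassFieldPrintedTorsion_of_reduced (D : GenusPointData n) (h : D.CMPointClassFieldPrintedReduced) :
    D.CMPointClassFieldPrintedTorsion := by
  obtain ⟨C, z, Φ, ΓH, ΓH', σ, θ, c, hc, hCox, hblk⟩ := h
  exact ⟨C, z, Φ, ΓH, ΓH', σ, θ, c, D.conjSpecCore_of_conjSpec hc, hCox, hblk⟩

/-- `CMPointClassFieldPrintedTorsion ⟹ CMPointClassFieldPrintedReduced` for `n ≠ 0`. [cite: TianYuanZhang2017, §3.1, Thm. 3.6] -/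
theorem cmPointClassFieldPrintedReduced_of_torsion (D : GenusPointData n) (hn : n ≠ 0)
    (h : D.CMPointClassFieldPrintedTorsion) : D.CMPointClassFieldPrintedReduced := by
  obtain ⟨C, z, Φ, ΓH, ΓH', σ, θ, c, hc, hCox, hblk⟩ := h
  exact ⟨C, z, Φ, ΓH, ΓH', σ, θ, c, D.conjSpec_of_core hn hc, hCox, hblk⟩

/-- **`CMPointClassFieldPrintedReduced ⟺ CMPointClassFieldPrintedTorsion`** for `n ≠ 0`. [cite: TianYuanZhang2017, §3.1, Thm. 3.6] -/
theorem cmPointClassFieldPrintedReduced_iff_torsion (D : GenusPointData n) (hn : n ≠ 0) :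
    D.CMPointClassFieldPrintedReduced ↔ D.CMPointClassFieldPrintedTorsion :=
  ⟨D.cmPointClassFieldPrintedTorsion_of_reduced, D.cmPointClassFieldPrintedReduced_of_torsion hn⟩

end GenusPointData

/-! ## §4 The ONE named fact, and its equivalences -/

/-- **Tian–Yuan–Zhang 2017, §3 with the CM-point layer and its class fields AS PRINTED, REDUCED TWICE, as ONE named fact**:
for every positive square-free `n ≡ 5, 6, 7 (mod 8)` there are data `D : GenusPointData n` satisfying `PrintedTorsion`
(`PrintedCore` with Lemma 3.18's derivable halves struck) and `CMPointClassFieldPrintedTorsion` (the reduced block layer with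
`ConjSpec`'s first conjunct struck).  EQUIVALENT in the kernel to `tyz_cmPointClassFieldDataReduced` and to
`tyz_cmPointClassFieldData`; no `_holds` expected; consumers take it as an explicit hypothesis; nothing is asserted here.
[cite: TianYuanZhang2017, §3: §3.1 (J738–J739), Prop. 3.2, Prop. 3.4, Thm. 3.5, Thm. 3.6 (J741), Lemma 3.16, Lemma 3.18, Lemma 3.21 and its proof (J759), §2.1 (J725)]
[cite: Cox2013, Theorem 6.1 (ii), Theorem 9.18, Lemma 9.3, (5.12)] -/
def tyz_cmPointClassFieldDataTorsion : Prop :=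
  ∀ (n : ℕ), Squarefree n → (n % 8 = 5 ∨ n % 8 = 6 ∨ n % 8 = 7) →
    ∃ D : GenusPointData n, D.PrintedTorsion ∧ D.CMPointClassFieldPrintedTorsion

/-- `tyz_cmPointClassFieldDataTorsion ⟹ tyz_cmPointClassFieldDataReduced`. [cite: TianYuanZhang2017, Lemma 3.18, Thm. 3.6] -/
theorem tyz_cmPointClassFieldDataReduced_of_torsion (h : tyz_cmPointClassFieldDataTorsion) :
    tyz_cmPointClassFieldDataReduced := by
  intro n hn h8
  obtain ⟨D, hD, hC⟩ := h n hn h8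
  exact ⟨D, D.printedCore_of_printedTorsion hn.ne_zero hD, D.cmPointClassFieldPrintedReduced_of_torsion hn.ne_zero hC⟩

/-- `tyz_cmPointClassFieldDataReduced ⟹ tyz_cmPointClassFieldDataTorsion`. [cite: TianYuanZhang2017, §3] -/
theorem tyz_cmPointClassFieldDataTorsion_of_reduced (h : tyz_cmPointClassFieldDataReduced) :
    tyz_cmPointClassFieldDataTorsion := by
  intro n hn h8
  obtain ⟨D, hD, hC⟩ := h n hn h8
  exact ⟨D, D.printedTorsion_of_printedCore hD, D.cmPointClassFieldPrintedTorsion_of_reduced hC⟩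

/-- **`tyz_cmPointClassFieldDataReduced ⟺ tyz_cmPointClassFieldDataTorsion`** in the kernel. [cite: TianYuanZhang2017, §3] -/
theorem tyz_cmPointClassFieldDataReduced_iff_torsion :
    tyz_cmPointClassFieldDataReduced ↔ tyz_cmPointClassFieldDataTorsion :=
  ⟨tyz_cmPointClassFieldDataTorsion_of_reduced, tyz_cmPointClassFieldDataReduced_of_torsion⟩

/-- `tyz_cmPointClassFieldDataTorsion ⟹ tyz_cmPointClassFieldData` (the direction the doors use). [cite: TianYuanZhang2017, §3] -/
theorem tyz_cmPointClassFieldData_of_torsion (h : tyz_cmPointClassFieldDataTorsion) : tyz_cmPointClassFieldData :=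
  tyz_cmPointClassFieldData_of_reduced (tyz_cmPointClassFieldDataReduced_of_torsion h)

/-- **`tyz_cmPointClassFieldData ⟺ tyz_cmPointClassFieldDataTorsion`** in the kernel. [cite: TianYuanZhang2017, §3] -/
theorem tyz_cmPointClassFieldData_iff_torsion : tyz_cmPointClassFieldData ↔ tyz_cmPointClassFieldDataTorsion :=
  tyz_cmPointClassFieldData_iff_reduced.trans tyz_cmPointClassFieldDataReduced_iff_torsion

end Literature.NumberTheory.EllipticCurves.TianYuanZhang2017

end
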